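/-
Copyright: the b2b-balaban T⁴-continuum CRUX team, row NE7b OWNER lineage `t4-ne7b-p1` (gen 124). Project licence.
-/
import Summits.QuantumFields.BalabanUV.T4Continuum.Spine.NE7b.SupZdResponseKernel

/-!
# THE INFINITE-VOLUME FLUCTUATION COVARIANCE ON EVERY BOUNDED SOURCE: for `V : ℤ^d → [−λ, Λ]` (`d ≥ 3`, every mesh), ANY bounded block
# columns `Ψ`, ANY cube limit `M = T_∞⁻¹` and every `f ∈ ℓ^∞(ℤ^d)` with bounded solution `u = H_V⁻¹f`: the response part
# `h = Σ′_{b″}m(b″)h_{b″}` (`m` = block means of `u`, `h_{b″}` = (200)'s kernels) converges absolutely, `|u − h| ≤ C‖f‖_∞`, `Q′(u − h) = 0` and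
# `H_V(u − h) = f − (Σ′_{b″}m(b″)M(·,b″))∘blk` — (201)'s displays of `C_∞f = u − h` for ALL bounded sources (the decay of the response kernels
# in `|blk n p − b″|₁` carries the series, no decay of the source needed), `C` from `(d, a, λ, Λ)` ONLY (row NE7b, node U5c; (180)∕(181)∕
# (194)∕(200) BY NAME; [folklore])

Cell `pub-balaban`, sub-cell `t4`, spine estimate NE7b (`T4WeightBudget.RelWeightBound`; the cell's OWN estimate — NOT PRINTED in
[Bałaban 1983–89], NOT PROVED).  Crux-route work under `Spine/NE7b/` by the row OWNER (`t4-ne7b-p1` gen 124, file (211)) under FREEZE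
(0)'s crux-prover clause; NOTHING of Bałaban's is named as a Lean object, valued or asserted; no `T4Continuum/Support` leaf typed; no `def`,
no notation (everything WRITTEN OUT; `u` enters with its displayed equation); zero `sorry`.  Imports (BY NAME): the OWNER's (200)
`…SupZdResponseKernel` (`zd_response_kernel`; through it (194) `zd_coarse_section_inverse`, (189) `summable_exp_l1`, `tsum_exp_l1_le`, (181)
`zd_bounded_solution_unique`, (180) `zd_solution_exists`), Mathlib's `Summable.tsum_finsetSum ∕ tsum_mul_left ∕ tsum_add ∕ tsum_sub`,
`norm_tsum_le_tsum_norm`, `tsum_eq_single`.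

WHY (located).  (201) treated block sources (with decay of the fluctuation part); the covariance as an OPERATOR needs all of `ℓ^∞`.
Nothing changes in the mechanism: `|u| ≤ C₀‖f‖` ((180)+(181)) bounds the block means, the response kernels decay in `|blk n p − b″|₁`
((200)), so `Σ′_{b″}m(b″)h_{b″}(p)` is dominated by `C₀‖f‖C_re^{−δ_r|blk n p − b″|₁}` — summable with sum `≤ C₀‖f‖C_rK_{δ_r}` ((189)) — and the
coarse series `Σ′_{b″}m(b″)M(b,b″)` by `C₀‖f‖c₁e^{−δ₁|b − b″|₁}`; block means and the finite stencil pass through the series termwise.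

WHAT IS PROVED ([folklore]): **`zd_fluctuation_bounded`** (THE END: `∃ C > 0`: for ALL `n, V, Ψ`, ANY cube limit `M`, every `|f| ≤ M_f` and
bounded solution `u`: both series converge absolutely, (i) `|u(p) − h(p)| ≤ CM_f`, (ii) `(n+1)^{−d}Σ_{B n b}(u − h) = 0`, (iii)
`H_V(u − h)(p) = f(p) − Σ′_{b″}m(b″)M(blk n p, b″)`); §2 toy.

HONEST (what this is NOT).  Pointwise displays (the operator `C_∞ ∈ L(ℓ^∞)` packaging à la (203) is not typed); no decay statement (none
holds for general `f`); the LINEAR column only; `d ≥ 3` only; scalar skeleton ((A3), NC-NE7b-α UNRULED); nothing of the covariant propagators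
of [B4]–[B6]; nothing of Bałaban's asserted.  BY-NAME EFFECT ON THE WALL: NONE.  NE7b NOT PRINTED ∕ NOT PROVED; spine PROVED 0∕9; rung (B)+1 —
the programme's measures remain FINITE-torus statements; NOT the mass gap, NOT Clay.  HONEST DEPENDENCY: continuum YM on T⁴ ⇐ BetaPertH
∧ nine spine estimates (0∕9 proved); BetaPertH ⇐ (D1) ∧ (D4) ∧ CAP+tail; G-an2-4 gates asym, D1 and NE2∕3∕4.
-/

set_option autoImplicit false

noncomputable section

namespace Summit.QuantumFields.BalabanUV.T4Continuum.NE7b.SupZdCovarianceBounded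

open Real Filter Topology
open Literature.MathematicalPhysics.QuantumFieldTheory.Balaban1983to89
open B6QGQLower276 (X e blk B side chart mem_B sum_B sum_B_const card_cube blk_chart)
open SupZdPropagatorLimit (zd_solution_exists)
open SupZdPropagatorUniqueness (zd_bounded_solution_unique)
open SupZdExponentialSums (summable_exp_l1 tsum_exp_l1_le)
open SupZdCoarseInverse (zd_coarse_section_inverse)
open SupZdResponseKernel (zd_response_kernel)

variable {d : ℕ}

/-! ## §1. THE END: the fluctuation covariance on every bounded source -/

/-- **HEADLINE — THE INFINITE-VOLUME FLUCTUATION COVARIANCE ACTS ON `ℓ^∞(ℤ^d)`**: `d ≥ 3`, `a > 0`, `λ < min(2,a)`, `Λ ≥ 0` ⟹ `∃ C > 0` (from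
`(d, a, λ, Λ)` ONLY) such that for ALL `n`, `V : ℤ^d → [−λ, Λ]`, ANY bounded block columns `Ψ`, ANY cube limit `M` (= `T_∞⁻¹`), every BOUNDED
source `|f| ≤ M_f` and THE bounded solution `u` of `H_Vu = f`: with the block means `m(b″) = (n+1)^{−d}Σ_{B n b″}u` (bounded) and the response
part `h = Σ′_{b″}m(b″)h_{b″}` ((200)'s kernels): the series converges absolutely at every point together with the coarse series
`Σ′_{b″}m(b″)M(b,b″)`, (i) `|u − h| ≤ C·M_f`; (ii) `Q′(u − h) = 0`; (iii) `H_V(u − h) = f − (Σ′_{b″}m(b″)M(·,b″))∘blk` — (201) for every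
`f ∈ ℓ^∞(ℤ^d)`, the decay of the response kernels replacing that of the source. [folklore] -/
theorem zd_fluctuation_bounded (hd : 3 ≤ d) (a : ℝ) (ha : 0 < a) {lam Lam : ℝ} (hlam : lam < min 2 a) (hLam : 0 ≤ Lam) :
    ∃ C : ℝ, 0 < C ∧ ∀ (n : ℕ) (V : X d → ℝ), (∀ p, -lam ≤ V p) → (∀ p, V p ≤ Lam) →
      ∀ (Ψ : X d → X d → ℝ) (BΨ : X d → ℝ), (∀ b' p, |Ψ b' p| ≤ BΨ b') →
      (∀ b' p, ((n : ℝ) + 1) ^ 2 * ∑ μ, (2 * Ψ b' p - Ψ b' (p + e μ) - Ψ b' (p - e μ))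
        + a / ((n : ℝ) + 1) ^ d * ∑ q ∈ B n (blk n p), Ψ b' q + V p * Ψ b' p = if blk n p = b' then 1 else 0) →
      ∀ (M : X d → X d → ℝ), (∀ b b' : X d, Tendsto (fun R : ℕ =>
          if h : b ∈ (Fintype.piFinset fun _ : Fin d => Finset.Icc (-(R : ℤ)) R) ∧
              b' ∈ (Fintype.piFinset fun _ : Fin d => Finset.Icc (-(R : ℤ)) R)
            then (Matrix.of fun c c' : ↥(Fintype.piFinset fun _ : Fin d => Finset.Icc (-(R : ℤ)) R) =>
              (((n : ℝ) + 1) ^ d)⁻¹ * ∑ q ∈ B n (c : X d), Ψ (c' : X d) q)⁻¹ ⟨b, h.1⟩ ⟨b', h.2⟩ else 0)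
        atTop (𝓝 (M b b'))) →
      ∀ (Mf : ℝ) (f : X d → ℝ), (∀ p, |f p| ≤ Mf) →
      ∀ (u : X d → ℝ) (Bu : ℝ), (∀ p, |u p| ≤ Bu) →
      (∀ p, ((n : ℝ) + 1) ^ 2 * ∑ μ, (2 * u p - u (p + e μ) - u (p - e μ))
        + a / ((n : ℝ) + 1) ^ d * ∑ q ∈ B n (blk n p), u q + V p * u p = f p) →
        (∀ p, Summable fun b'' : X d => ((((n : ℝ) + 1) ^ d)⁻¹ * ∑ q ∈ B n b'', u q) * ∑' b' : X d, M b' b'' * Ψ b' p) ∧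
        (∀ b, Summable fun b'' : X d => ((((n : ℝ) + 1) ^ d)⁻¹ * ∑ q ∈ B n b'', u q) * M b b'') ∧
        (∀ p, |u p - ∑' b'' : X d, ((((n : ℝ) + 1) ^ d)⁻¹ * ∑ q ∈ B n b'', u q) * ∑' b' : X d, M b' b'' * Ψ b' p| ≤ C * Mf) ∧
        (∀ b, (((n : ℝ) + 1) ^ d)⁻¹ * ∑ q ∈ B n b,
          (u q - ∑' b'' : X d, ((((n : ℝ) + 1) ^ d)⁻¹ * ∑ q' ∈ B n b'', u q') * ∑' b' : X d, M b' b'' * Ψ b' q) = 0) ∧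
        (∀ p, ((n : ℝ) + 1) ^ 2 * ∑ μ,
            (2 * (u p - ∑' b'' : X d, ((((n : ℝ) + 1) ^ d)⁻¹ * ∑ q ∈ B n b'', u q) * ∑' b' : X d, M b' b'' * Ψ b' p)
            - (u (p + e μ) - ∑' b'' : X d, ((((n : ℝ) + 1) ^ d)⁻¹ * ∑ q ∈ B n b'', u q) * ∑' b' : X d, M b' b'' * Ψ b' (p + e μ))
            - (u (p - e μ) - ∑' b'' : X d, ((((n : ℝ) + 1) ^ d)⁻¹ * ∑ q ∈ B n b'', u q) * ∑' b' : X d, M b' b'' * Ψ b' (p - e μ)))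
          + a / ((n : ℝ) + 1) ^ d * ∑ q ∈ B n (blk n p),
            (u q - ∑' b'' : X d, ((((n : ℝ) + 1) ^ d)⁻¹ * ∑ q' ∈ B n b'', u q') * ∑' b' : X d, M b' b'' * Ψ b' q)
          + V p * (u p - ∑' b'' : X d, ((((n : ℝ) + 1) ^ d)⁻¹ * ∑ q ∈ B n b'', u q) * ∑' b' : X d, M b' b'' * Ψ b' p)
          = f p - ∑' b'' : X d, ((((n : ℝ) + 1) ^ d)⁻¹ * ∑ q ∈ B n b'', u q) * M (blk n p) b'') := by
  classical
  obtain ⟨C₀, hC₀, H180⟩ := zd_solution_exists (d := d) hd a ha hlam hLam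
  obtain ⟨Cr, δr, hCr, hδr, H200⟩ := zd_response_kernel (d := d) hd a ha hlam hLam
  obtain ⟨c₁, δ₁, hc₁, hδ₁, H4⟩ := zd_coarse_section_inverse (d := d) hd a ha hlam hLam
  set K : ℝ := (2 * (1 - exp (-δr))⁻¹) ^ d with hK
  have hK0 : 0 < K := pow_pos (mul_pos two_pos (inv_pos.2 (sub_pos.2 (exp_lt_one_iff.2 (by linarith))))) d
  refine ⟨C₀ + C₀ * Cr * K, by positivity, ?_⟩
  intro n V hV hV' Ψ BΨ hΨB hΨ M hM Mf f hfM u Bu huB hu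
  have hMf : 0 ≤ Mf := (abs_nonneg _).trans (hfM 0)
  have hvol : (0 : ℝ) < ((n : ℝ) + 1) ^ d := by positivity
  have hrbd := H200 n V hV hV' Ψ BΨ hΨB hΨ M hM
  -- abbreviations
  obtain ⟨mu, hmu⟩ : ∃ mu : X d → ℝ, ∀ b'', mu b'' = (((n : ℝ) + 1) ^ d)⁻¹ * ∑ q ∈ B n b'', u q := ⟨_, fun _ => rfl⟩
  obtain ⟨hr, hhr⟩ : ∃ hr : X d → X d → ℝ, ∀ b'' p, hr b'' p = ∑' b' : X d, M b' b'' * Ψ b' p := ⟨_, fun _ _ => rfl⟩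
  -- `u` is (180)'s bounded solution; its block means are bounded
  obtain ⟨v, hveq, hvB⟩ := H180 n V hV hV' Mf f hfM
  have huv : u = v := zd_bounded_solution_unique hd a ha hlam hLam n V hV hV' f u v huB hvB hu hveq
  have hud : ∀ p, |u p| ≤ C₀ * Mf := fun p => by rw [huv]; exact hvB p
  have hmud : ∀ b'', |mu b''| ≤ C₀ * Mf := by
    intro b''
    rw [hmu, abs_mul, abs_inv, abs_of_pos hvol, inv_mul_le_iff₀ hvol]
    calc |∑ q ∈ B n b'', u q| ≤ ∑ q ∈ B n b'', |u q| := Finset.abs_sum_le_sum_abs _ _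
      _ ≤ ∑ _q ∈ B n b'', C₀ * Mf := Finset.sum_le_sum fun q _ => hud q
      _ = _ := sum_B_const _ _
  have hrd : ∀ b'' p, |hr b'' p| ≤ Cr * exp (-(δr * ∑ i, (((blk n p i - b'' i).natAbs : ℕ) : ℝ))) := fun b'' p => by
    rw [hhr]; exact (hrbd b'').2.1 p
  have hMd : ∀ b b'', |M b b''| ≤ c₁ * exp (-(δ₁ * ∑ i, (((b i - b'' i).natAbs : ℕ) : ℝ))) := fun b b'' => by
    refine le_of_tendsto' (hM b b'').abs fun R => ?_
    split_ifs with h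
    · exact (H4 n V hV hV' Ψ BΨ hΨB hΨ _ _ (Finset.Subset.refl _)).1 ⟨b, h.1⟩ ⟨b'', h.2⟩
    · rw [abs_zero]; positivity
  -- the response series: domination, absolute convergence, bound
  have hdom : ∀ p b'', |mu b'' * hr b'' p| ≤ C₀ * Mf * Cr * exp (-(δr * ∑ i, (((blk n p i - b'' i).natAbs : ℕ) : ℝ))) := fun p b'' => by
    rw [abs_mul]
    calc |mu b''| * |hr b'' p| ≤ (C₀ * Mf) * (Cr * exp (-(δr * ∑ i, (((blk n p i - b'' i).natAbs : ℕ) : ℝ)))) :=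
          mul_le_mul (hmud b'') (hrd b'' p) (abs_nonneg _) (by positivity)
      _ = _ := by ring
  have hs : ∀ p, Summable fun b'' : X d => mu b'' * hr b'' p := fun p =>
    Summable.of_norm_bounded ((summable_exp_l1 hδr (blk n p)).mul_left (C₀ * Mf * Cr)) fun b'' => by
      rw [Real.norm_eq_abs]; exact hdom p b''
  have hsM : ∀ b, Summable fun b'' : X d => mu b'' * M b b'' := fun b =>
    Summable.of_norm_bounded ((summable_exp_l1 hδ₁ b).mul_left (C₀ * Mf * c₁)) fun b'' => by
      rw [Real.norm_eq_abs, abs_mul]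
      calc |mu b''| * |M b b''| ≤ (C₀ * Mf) * (c₁ * exp (-(δ₁ * ∑ i, (((b i - b'' i).natAbs : ℕ) : ℝ)))) :=
            mul_le_mul (hmud b'') (hMd b b'') (abs_nonneg _) (by positivity)
        _ = _ := by ring
  have hhd : ∀ p, |∑' b'' : X d, mu b'' * hr b'' p| ≤ C₀ * Mf * Cr * K := by
    intro p
    have h1 : |∑' b'' : X d, mu b'' * hr b'' p| ≤ ∑' b'' : X d, |mu b'' * hr b'' p| := by
      have := norm_tsum_le_tsum_norm (hs p).norm; simpa only [Real.norm_eq_abs] using this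
    have h2 := (hs p).abs.tsum_le_tsum (hdom p) ((summable_exp_l1 hδr (blk n p)).mul_left (C₀ * Mf * Cr))
    rw [(summable_exp_l1 hδr (blk n p)).tsum_mul_left] at h2
    have h3 := mul_le_mul_of_nonneg_left (tsum_exp_l1_le hδr (blk n p)) (show 0 ≤ C₀ * Mf * Cr by positivity)
    rw [← hK] at h3
    exact h1.trans (h2.trans h3)
  -- fold the displays
  have efold : ∀ p, (fun b'' : X d => ((((n : ℝ) + 1) ^ d)⁻¹ * ∑ q ∈ B n b'', u q) * ∑' b' : X d, M b' b'' * Ψ b' p)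
      = fun b'' => mu b'' * hr b'' p := fun p => funext fun b'' => by rw [hmu, hhr]
  have efoldM : ∀ b, (fun b'' : X d => ((((n : ℝ) + 1) ^ d)⁻¹ * ∑ q ∈ B n b'', u q) * M b b'') = fun b'' => mu b'' * M b b'' :=
    fun b => funext fun b'' => by rw [hmu]
  simp only [efold, efoldM]
  refine ⟨hs, hsM, fun p => ?_, fun b => ?_, fun p => ?_⟩
  · -- (i) the bound
    calc |u p - ∑' b'' : X d, mu b'' * hr b'' p| ≤ |u p| + |∑' b'' : X d, mu b'' * hr b'' p| := abs_sub _ _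
      _ ≤ C₀ * Mf + C₀ * Mf * Cr * K := add_le_add (hud p) (hhd p)
      _ = (C₀ + C₀ * Cr * K) * Mf := by ring
  · -- (ii) zero block means
    have hmean : (((n : ℝ) + 1) ^ d)⁻¹ * ∑ q ∈ B n b, ∑' b'' : X d, mu b'' * hr b'' q = mu b := by
      rw [← Summable.tsum_finsetSum (fun q _ => hs q), ← Summable.tsum_mul_left _ (summable_sum fun q _ => hs q)]
      have e1 : ∀ b'' : X d, (((n : ℝ) + 1) ^ d)⁻¹ * ∑ q ∈ B n b, mu b'' * hr b'' q = mu b'' * (if b = b'' then 1 else 0) := by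
        intro b''
        rw [← (hrbd b'').2.2.1 b, Finset.mul_sum, Finset.mul_sum, Finset.mul_sum]
        exact Finset.sum_congr rfl fun q _ => by rw [hhr]; ring
      simp only [e1]
      rw [tsum_eq_single b (fun b'' hb'' => by rw [if_neg (Ne.symm hb''), mul_zero]), if_pos rfl, mul_one]
    rw [Finset.sum_sub_distrib, mul_sub, hmean, hmu, sub_self]
  · -- (iii) the equation
    have hpt : ∑' b'' : X d, (((n : ℝ) + 1) ^ 2 * ∑ μ, (2 * (mu b'' * hr b'' p) - mu b'' * hr b'' (p + e μ) - mu b'' * hr b'' (p - e μ))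
        + a / ((n : ℝ) + 1) ^ d * ∑ q ∈ B n (blk n p), mu b'' * hr b'' q + V p * (mu b'' * hr b'' p))
        = ∑' b'' : X d, mu b'' * M (blk n p) b'' := by
      refine tsum_congr fun b'' => ?_
      have h3 := (hrbd b'').2.2.2 p
      simp only [← hhr] at h3
      rw [← h3, ← Finset.mul_sum]
      have e2 : ∑ μ, (2 * (mu b'' * hr b'' p) - mu b'' * hr b'' (p + e μ) - mu b'' * hr b'' (p - e μ))
          = mu b'' * ∑ μ, (2 * hr b'' p - hr b'' (p + e μ) - hr b'' (p - e μ)) := by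
        rw [Finset.mul_sum]; exact Finset.sum_congr rfl fun μ _ => by ring
      rw [e2]; ring
    have hS1 : ∀ μ : Fin d, Summable fun b'' : X d => 2 * (mu b'' * hr b'' p) - mu b'' * hr b'' (p + e μ) - mu b'' * hr b'' (p - e μ) :=
      fun μ => (((hs p).mul_left 2).sub (hs (p + e μ))).sub (hs (p - e μ))
    have hS1s : Summable fun b'' : X d => ∑ μ, (2 * (mu b'' * hr b'' p) - mu b'' * hr b'' (p + e μ) - mu b'' * hr b'' (p - e μ)) :=
      summable_sum fun μ _ => hS1 μ
    have hS2 : Summable fun b'' : X d => ∑ q ∈ B n (blk n p), mu b'' * hr b'' q := summable_sum fun q _ => hs q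
    have hT1 : ∑' b'' : X d, ∑ μ, (2 * (mu b'' * hr b'' p) - mu b'' * hr b'' (p + e μ) - mu b'' * hr b'' (p - e μ))
        = ∑ μ, (2 * (∑' b'' : X d, mu b'' * hr b'' p) - (∑' b'' : X d, mu b'' * hr b'' (p + e μ))
          - (∑' b'' : X d, mu b'' * hr b'' (p - e μ))) := by
      rw [Summable.tsum_finsetSum fun μ _ => hS1 μ]
      refine Finset.sum_congr rfl fun μ _ => ?_
      rw [(((hs p).mul_left 2).sub (hs (p + e μ))).tsum_sub (hs (p - e μ)), ((hs p).mul_left 2).tsum_sub (hs (p + e μ)),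
        (hs p).tsum_mul_left 2]
    have hT2 : ∑' b'' : X d, ∑ q ∈ B n (blk n p), mu b'' * hr b'' q = ∑ q ∈ B n (blk n p), ∑' b'' : X d, mu b'' * hr b'' q :=
      Summable.tsum_finsetSum fun q _ => hs q
    have hmain : ∑' b'' : X d, (((n : ℝ) + 1) ^ 2 * ∑ μ, (2 * (mu b'' * hr b'' p) - mu b'' * hr b'' (p + e μ) - mu b'' * hr b'' (p - e μ))
        + a / ((n : ℝ) + 1) ^ d * ∑ q ∈ B n (blk n p), mu b'' * hr b'' q + V p * (mu b'' * hr b'' p))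
        = ((n : ℝ) + 1) ^ 2 * ∑' b'' : X d, ∑ μ, (2 * (mu b'' * hr b'' p) - mu b'' * hr b'' (p + e μ) - mu b'' * hr b'' (p - e μ))
          + a / ((n : ℝ) + 1) ^ d * ∑' b'' : X d, ∑ q ∈ B n (blk n p), mu b'' * hr b'' q
          + V p * ∑' b'' : X d, mu b'' * hr b'' p := by
      rw [Summable.tsum_add ((hS1s.mul_left _).add (hS2.mul_left _)) ((hs p).mul_left _),
        Summable.tsum_add (hS1s.mul_left _) (hS2.mul_left _), hS1s.tsum_mul_left (((n : ℝ) + 1) ^ 2),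
        hS2.tsum_mul_left (a / ((n : ℝ) + 1) ^ d), (hs p).tsum_mul_left (V p)]
    have hHh : ((n : ℝ) + 1) ^ 2 * ∑ μ, (2 * (∑' b'' : X d, mu b'' * hr b'' p) - (∑' b'' : X d, mu b'' * hr b'' (p + e μ))
          - (∑' b'' : X d, mu b'' * hr b'' (p - e μ)))
        + a / ((n : ℝ) + 1) ^ d * ∑ q ∈ B n (blk n p), (∑' b'' : X d, mu b'' * hr b'' q) + V p * (∑' b'' : X d, mu b'' * hr b'' p)
        = ∑' b'' : X d, mu b'' * M (blk n p) b'' := by rw [← hpt, hmain, hT1, hT2]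
    rw [← hHh, ← hu p]
    have e1 : ∑ μ, (2 * (u p - ∑' b'' : X d, mu b'' * hr b'' p) - (u (p + e μ) - ∑' b'' : X d, mu b'' * hr b'' (p + e μ))
        - (u (p - e μ) - ∑' b'' : X d, mu b'' * hr b'' (p - e μ)))
        = ∑ μ, (2 * u p - u (p + e μ) - u (p - e μ)) - ∑ μ, (2 * (∑' b'' : X d, mu b'' * hr b'' p)
          - (∑' b'' : X d, mu b'' * hr b'' (p + e μ)) - (∑' b'' : X d, mu b'' * hr b'' (p - e μ))) := by
      rw [← Finset.sum_sub_distrib]; exact Finset.sum_congr rfl fun μ _ => by ring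
    have e2 : ∑ q ∈ B n (blk n p), (u q - ∑' b'' : X d, mu b'' * hr b'' q)
        = ∑ q ∈ B n (blk n p), u q - ∑ q ∈ B n (blk n p), ∑' b'' : X d, mu b'' * hr b'' q :=
      Finset.sum_sub_distrib (f := fun q => u q) (g := fun q => ∑' b'' : X d, mu b'' * hr b'' q)
    rw [e1, e2]
    ring

/-! ## §2. Toy -/

/-- Toy (`d = 3`, `a = 1`, `λ = 0`, `Λ = 1`): the `ℓ^∞` constant of the fluctuation covariance exists. -/
example : ∃ C : ℝ, 0 < C :=
  let ⟨C, hC, _⟩ := zd_fluctuation_bounded (d := 3) le_rfl 1 one_pos (lam := 0) (Lam := 1)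
    (by rw [min_eq_right (by norm_num : (1 : ℝ) ≤ 2)]; norm_num) zero_le_one
  ⟨C, hC⟩

end Summit.QuantumFields.BalabanUV.T4Continuum.NE7b.SupZdCovarianceBounded
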